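import Mathlib
import Literature.MathematicalPhysics.QuantumLattice.TraceInequalities

/-!
# Route BalabanIR — crux 3 `BirBdGPhaseCoercivity` (item `stmt-HubbardSuperconductivity-2081`):
# I. Two-sided trace-norm bounds (the metric majorant and the unitary minorant)

Generic matrix analysis for the frozen-Nambu-metric reduction of the phase-coercivity crux
(crux ideas `frozen-nambu-metric`, `sqrt-concavity-multiplier`). For a Hermitian matrix `X`
write `‖X‖₁ = Σ_i |λ_i(X)|` (sum of the absolute values of the eigenvalues).

* `sum_abs_eigenvalues_le_metric_majorant` — the AM–GM / Fenchel MAJORANT: for every positive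
  definite `G`, `‖X‖₁ ≤ ½ (Re Tr (G X²) + Re Tr G⁻¹)` (equality iff `G = |X|⁻¹`). Proof: with
  `C = |X|` (continuous functional calculus; `C² = X²`, `Tr C = ‖X‖₁`) and `W = C - G⁻¹`,
  `0 ≤ Tr (Wᴴ G W) = Tr (G C²) - 2 Tr C + Tr G⁻¹`.
* `re_trace_mul_unitary_le_sum_abs_eigenvalues` — the dual MINORANT: `Re Tr (X V) ≤ ‖X‖₁` for
  `V` unitary (entries of a unitary matrix are bounded by one in the eigenbasis of `X`).
* `half_re_trace_metric_deficit_le` — the combination used by the crux: if `M` is positive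
  definite, commutes with `X₀` and `M² = X₀²` (so `M = |X₀|`), then for every Hermitian `X`,
  `½ Re Tr (M⁻¹ (X₀² - X²)) ≤ ‖X₀‖₁ - ‖X‖₁`.

References: R. Bhatia, *Matrix Analysis* (Springer 1997), §IV.2 (duality for unitarily invariant
norms); T. Kennedy, E. H. Lieb, Physica A 138 (1986) 320, proof of Thm. 1 (the `Tr√` tangent
argument this majorant abstracts). No definition is introduced.
-/

noncomputable section

open scoped ComplexOrder

namespace Summit.HubbardSuperconductivity.HubbardSuperconductivity.Theorems

open Matrix

variable {n : Type*} [Fintype n] [DecidableEq n]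

/-! ### The matrix absolute value through the continuous functional calculus -/

/-- `|X|` is Hermitian. [folklore] -/
theorem isHermitian_cfc_abs (X : Matrix n n ℂ) :
    (cfc (fun x : ℝ => |x|) X).IsHermitian := by
  have h : IsSelfAdjoint (cfc (fun x : ℝ => |x|) X) := cfc_predicate _ _
  exact h

/-- `|X|² = X²` for Hermitian `X`. [folklore] -/
theorem cfc_abs_mul_self {X : Matrix n n ℂ} (hX : X.IsHermitian) :
    cfc (fun x : ℝ => |x|) X * cfc (fun x : ℝ => |x|) X = X * X := by
  have hX' : IsSelfAdjoint X := hX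
  rw [← cfc_mul (fun x : ℝ => |x|) (fun x : ℝ => |x|) X]
  have : (fun x : ℝ => |x| * |x|) = fun x : ℝ => x * x := by
    funext x
    exact abs_mul_abs_self x
  rw [this, cfc_mul (fun x : ℝ => x) (fun x : ℝ => x) X, cfc_id' ℝ X]

/-- `Tr |X| = Σ_i |λ_i(X)|` for Hermitian `X`. [folklore] -/
theorem trace_cfc_abs {X : Matrix n n ℂ} (hX : X.IsHermitian) :
    (cfc (fun x : ℝ => |x|) X).trace = ∑ i, ((|hX.eigenvalues i| : ℝ) : ℂ) := by
  rw [hX.cfc_eq, Matrix.IsHermitian.cfc, Unitary.conjStarAlgAut_apply, Matrix.trace_mul_cycle,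
    Unitary.star_mul_self_of_mem (hX.eigenvectorUnitary).2, Matrix.one_mul,
    Matrix.trace_diagonal]
  simp only [Function.comp_apply]
  rfl

/-! ### The metric majorant -/

/-- **AM–GM / Fenchel majorant of the trace norm.** For Hermitian `X` and positive definite `G`,
`Σ_i |λ_i(X)| ≤ ½ (Re Tr (G X²) + Re Tr G⁻¹)` (Bhatia, *Matrix Analysis*, §IV.2; equality iff
`G = |X|⁻¹`). [cite: Bhatia1997, §IV.2] -/
theorem sum_abs_eigenvalues_le_metric_majorant (X G : Matrix n n ℂ) (hX : X.IsHermitian)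
    (hG : G.PosDef) :
    ∑ i, |hX.eigenvalues i| ≤ ((G * (X * X)).trace.re + (G⁻¹).trace.re) / 2 := by
  set C : Matrix n n ℂ := cfc (fun x : ℝ => |x|) X with hCdef
  have hC : C.IsHermitian := isHermitian_cfc_abs X
  have hCC : C * C = X * X := cfc_abs_mul_self hX
  have htr : C.trace = ∑ i, ((|hX.eigenvalues i| : ℝ) : ℂ) := trace_cfc_abs hX
  have hGi : G⁻¹.IsHermitian := hG.isHermitian.inv
  have hGG : G * G⁻¹ = 1 := Matrix.mul_nonsing_inv G ((Matrix.isUnit_iff_isUnit_det G).1 hG.isUnit)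
  have hGG' : G⁻¹ * G = 1 := Matrix.nonsing_inv_mul G ((Matrix.isUnit_iff_isUnit_det G).1 hG.isUnit)
  -- `0 ≤ Tr (Wᴴ G W)` with `W = C - G⁻¹`
  have hpsd : ((C - G⁻¹)ᴴ * G * (C - G⁻¹)).PosSemidef :=
    hG.posSemidef.conjTranspose_mul_mul_same (C - G⁻¹)
  have hW : (C - G⁻¹)ᴴ = C - G⁻¹ := by
    rw [Matrix.conjTranspose_sub, hC.eq, hGi.eq]
  have hexp : (C - G⁻¹)ᴴ * G * (C - G⁻¹) = C * G * C - C - C + G⁻¹ := by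
    rw [hW, Matrix.sub_mul, hGG', Matrix.sub_mul, Matrix.one_mul, Matrix.mul_sub,
      Matrix.mul_assoc C G G⁻¹, hGG, Matrix.mul_one]
    abel
  have h0 : 0 ≤ ((C - G⁻¹)ᴴ * G * (C - G⁻¹)).trace.re := by
    have := Literature.MathematicalPhysics.QuantumLattice.re_trace_nonneg_of_posSemidef hpsd
    simpa only [RCLike.re_to_complex] using this
  rw [hexp, Matrix.trace_add, Matrix.trace_sub, Matrix.trace_sub, Complex.add_re, Complex.sub_re,
    Complex.sub_re] at h0
  have hcyc : (C * G * C).trace = (G * (X * X)).trace := by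
    rw [Matrix.mul_assoc, Matrix.trace_mul_comm, Matrix.mul_assoc, hCC]
  have htr' : C.trace.re = ∑ i, |hX.eigenvalues i| := by
    rw [htr, Complex.re_sum]
    simp only [Complex.ofReal_re]
  rw [hcyc, htr'] at h0
  linarith

/-! ### The unitary minorant -/

/-- **Duality minorant of the trace norm.** For Hermitian `X` and unitary `V`,
`Re Tr (X V) ≤ Σ_i |λ_i(X)|` (Bhatia, *Matrix Analysis*, §IV.2: in the eigenbasis of `X`,
`Tr (X V) = Σ_i λ_i (U⋆ V U)_{ii}` and the entries of a unitary matrix have modulus `≤ 1`). [cite: Bhatia1997, §IV.2] -/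
theorem re_trace_mul_unitary_le_sum_abs_eigenvalues (X V : Matrix n n ℂ) (hX : X.IsHermitian)
    (hV : V ∈ Matrix.unitaryGroup n ℂ) :
    (X * V).trace.re ≤ ∑ i, |hX.eigenvalues i| := by
  set U : Matrix n n ℂ := (hX.eigenvectorUnitary : Matrix n n ℂ) with hUdef
  have hU : U ∈ Matrix.unitaryGroup n ℂ := hX.eigenvectorUnitary.2
  have hspec : X = U * diagonal (RCLike.ofReal ∘ hX.eigenvalues) * star U := by
    have := hX.spectral_theorem
    rw [Unitary.conjStarAlgAut_apply] at this
    exact this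
  -- `Tr (X V) = Tr (D (U⋆ V U))`
  have htr : (X * V).trace = (diagonal (RCLike.ofReal ∘ hX.eigenvalues) * (star U * V * U)).trace := by
    conv_lhs => rw [hspec]
    rw [show U * diagonal (RCLike.ofReal ∘ hX.eigenvalues) * star U * V =
        U * (diagonal (RCLike.ofReal ∘ hX.eigenvalues) * (star U * V)) by
      simp only [Matrix.mul_assoc]]
    rw [Matrix.trace_mul_comm]
    simp only [Matrix.mul_assoc]
  have hW : star U * V * U ∈ Matrix.unitaryGroup n ℂ :=
    Submonoid.mul_mem _ (Submonoid.mul_mem _ (Unitary.star_mem hU) hV) hU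
  rw [htr, Matrix.trace, Complex.re_sum]
  refine Finset.sum_le_sum fun i _ => ?_
  rw [Matrix.diag_apply, Matrix.diagonal_mul (d := RCLike.ofReal ∘ hX.eigenvalues)]
  have hent : ‖(star U * V * U) i i‖ ≤ 1 := entry_norm_bound_of_unitary hW i i
  calc ((RCLike.ofReal ∘ hX.eigenvalues) i * (star U * V * U) i i).re
      ≤ ‖(RCLike.ofReal ∘ hX.eigenvalues) i * (star U * V * U) i i‖ := Complex.re_le_norm _
    _ = |hX.eigenvalues i| * ‖(star U * V * U) i i‖ := by
        rw [norm_mul]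
        simp only [Function.comp_apply, RCLike.norm_ofReal]
    _ ≤ |hX.eigenvalues i| * 1 := by gcongr
    _ = |hX.eigenvalues i| := mul_one _

/-! ### The frozen-metric deficit bound -/

/-- **Frozen-metric deficit bound.** If `M` is positive definite, commutes with the Hermitian
matrix `X₀` and `M² = X₀²` (i.e. `M = |X₀|`), then for every Hermitian `X`,
`½ Re Tr (M⁻¹ (X₀² - X²)) ≤ Σ_i |λ_i(X₀)| - Σ_i |λ_i(X)|`: the metric majorant at `G = M⁻¹`
for `X` together with the unitary minorant at `V = X₀ M⁻¹` for `X₀` (crux ideas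
`frozen-nambu-metric` / `sqrt-concavity-multiplier` for `BirBdGPhaseCoercivity`). [folklore] -/
theorem half_re_trace_metric_deficit_le (X₀ X M : Matrix n n ℂ) (hX₀ : X₀.IsHermitian)
    (hX : X.IsHermitian) (hM : M.PosDef) (hcomm : X₀ * M = M * X₀) (hsq : M * M = X₀ * X₀) :
    (M⁻¹ * (X₀ * X₀ - X * X)).trace.re / 2 ≤
      ∑ i, |hX₀.eigenvalues i| - ∑ i, |hX.eigenvalues i| := by
  have hMdet : IsUnit M.det := (Matrix.isUnit_iff_isUnit_det M).1 hM.isUnit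
  have hMM : M * M⁻¹ = 1 := Matrix.mul_nonsing_inv M hMdet
  have hMM' : M⁻¹ * M = 1 := Matrix.nonsing_inv_mul M hMdet
  have hMi : M⁻¹.IsHermitian := hM.isHermitian.inv
  -- upper bound for `X` with `G = M⁻¹`
  have hup := sum_abs_eigenvalues_le_metric_majorant X M⁻¹ hX hM.inv
  rw [Matrix.nonsing_inv_nonsing_inv M hMdet] at hup
  -- lower bound for `X₀` with `V = X₀ M⁻¹`
  have hcomm' : M⁻¹ * X₀ = X₀ * M⁻¹ := by
    calc M⁻¹ * X₀ = M⁻¹ * X₀ * (M * M⁻¹) := by rw [hMM, Matrix.mul_one]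
      _ = M⁻¹ * (X₀ * M) * M⁻¹ := by simp only [Matrix.mul_assoc]
      _ = M⁻¹ * (M * X₀) * M⁻¹ := by rw [hcomm]
      _ = X₀ * M⁻¹ := by rw [← Matrix.mul_assoc, hMM', Matrix.one_mul]
  have hV : X₀ * M⁻¹ ∈ Matrix.unitaryGroup n ℂ := by
    rw [Matrix.mem_unitaryGroup_iff']
    rw [star_eq_conjTranspose, Matrix.conjTranspose_mul, hMi.eq, hX₀.eq]
    calc M⁻¹ * X₀ * (X₀ * M⁻¹) = M⁻¹ * (X₀ * X₀) * M⁻¹ := by simp only [Matrix.mul_assoc]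
      _ = M⁻¹ * (M * M) * M⁻¹ := by rw [hsq]
      _ = 1 := by rw [← Matrix.mul_assoc, hMM', Matrix.one_mul, hMM]
  have hlow := re_trace_mul_unitary_le_sum_abs_eigenvalues X₀ (X₀ * M⁻¹) hX₀ hV
  have htrV : (X₀ * (X₀ * M⁻¹)).trace = M.trace := by
    rw [← Matrix.mul_assoc, ← hsq, Matrix.mul_assoc, hMM, Matrix.mul_one]
  rw [htrV] at hlow
  -- combine
  have hsplit : (M⁻¹ * (X₀ * X₀ - X * X)).trace.re = M.trace.re - (M⁻¹ * (X * X)).trace.re := by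
    rw [Matrix.mul_sub, Matrix.trace_sub, Complex.sub_re, ← hsq, ← Matrix.mul_assoc, hMM',
      Matrix.one_mul]
  rw [hsplit]
  linarith
  
end Summit.HubbardSuperconductivity.HubbardSuperconductivity.Theorems

end
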